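import Mathlib
import HarnessLib

/-!
# Format C, design C∞: the limit-coupling majorant `Uq` split into an exact middle range and an envelope tail

Route context: Fourier–Galerkin / Schur-complement certificates of Weil positivity on a window ("format C";
cell memo `run/shared/lean/pub/rh-explicit/rh-explicit-weil-10/KERNEL-LEVER.md` §19 (rung recipe, item (3)); supporting
stmt-RiemannHypothesis-0098; seat rh-explicit-weil-10).

The C∞ front door (`weilPositivityOn_of_formatC_cinf`) asks the data side for ONE majorant of the limit coupling,
`Σ_{m∈[B,N)} (Σ_i M(i,m)x_i + Σ_j c∞(m,j)β_j)²/d̂_m ≤ Uq(x,β)` for EVERY truncation `N`.  This file is the bookkeeping that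
splits it exactly like today's two-range doors (`sum_range_mul_mul_nonneg_of_certificate_sum_split`): an exact majorant
`Ufin` on a middle range `[B, B₃)` (kernel boxes of the closed-form images, `columns_majorant`) plus a TAIL CONSTANT `T` from
termwise envelopes `|M(i,m)| ≤ a_i(m)`, `|c∞(m,j)| ≤ b_j(m)` on `[B₃, ∞)` with `Σ_{m∈[B₃,N)} (Σ_i a_i(m)² + Σ_j b_j(m)²)/d̂_m ≤ T`:

* `sq_add_le_mul` — the two-block Cauchy–Schwarz `(Σ_i u_i x_i + Σ_j v_j β_j)² ≤ (Σu² + Σv²)(Σx² + Σβ²)`;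
* `sq_image_le_envelope_mul` — with envelopes: `(Σ_i M(i,m)x_i + Σ_j c(m,j)β_j)² ≤ (Σ_i a_i(m)² + Σ_j b_j(m)²)(Σx² + Σβ²)`;
* `coupling_majorant_split` — `Uq(x,β) := Ufin(x,β) + T·(Σx² + Σβ²)` majorises the coupling for every `N`.

Pure finite-dimensional real algebra; standard axioms; nothing Weil-specific; no RH claim.
-/

-- `Summit.RiemannHypothesis.RiemannHypothesis.…` is the layout-mandated namespace (summit = problem name).
set_option linter.dupNamespace false

namespace Summit.RiemannHypothesis.RiemannHypothesis.Theorems.WeilFormatC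

open Finset

/-- **Two-block Cauchy–Schwarz**: `(Σ_i u_i x_i + Σ_j v_j β_j)² ≤ (Σ_i u_i² + Σ_j v_j²)(Σ_i x_i² + Σ_j β_j²)`. -/
theorem sq_add_le_mul {B r : ℕ} (u x : Fin B → ℝ) (v β : Fin r → ℝ) :
    (∑ i, u i * x i + ∑ j, v j * β j) ^ 2 ≤ (∑ i, u i ^ 2 + ∑ j, v j ^ 2) * (∑ i, x i ^ 2 + ∑ j, β j ^ 2) := by
  have h := Finset.sum_mul_sq_le_sq_mul_sq (Finset.univ : Finset (Fin B ⊕ Fin r)) (Sum.elim u v) (Sum.elim x β)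
  simpa only [Fintype.sum_sum_type, Sum.elim_inl, Sum.elim_inr] using h

/-- **Envelopes on the image rows give a quadratic bound**: if `|M(i,m)| ≤ a_i(m)` and `|c(m,j)| ≤ b_j(m)` then
`(Σ_i M(i,m)x_i + Σ_j c(m,j)β_j)² ≤ (Σ_i a_i(m)² + Σ_j b_j(m)²)(Σ x_i² + Σ β_j²)`. -/
theorem sq_image_le_envelope_mul {B r : ℕ} {Mi : Fin B → ℝ} {cj : Fin r → ℝ} {a : Fin B → ℝ} {b : Fin r → ℝ}
    (ha : ∀ i, |Mi i| ≤ a i) (hb : ∀ j, |cj j| ≤ b j) (x : Fin B → ℝ) (β : Fin r → ℝ) :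
    (∑ i, Mi i * x i + ∑ j, cj j * β j) ^ 2 ≤ (∑ i, a i ^ 2 + ∑ j, b j ^ 2) * (∑ i, x i ^ 2 + ∑ j, β j ^ 2) := by
  have h := sq_add_le_mul Mi x cj β
  have hz : 0 ≤ ∑ i, x i ^ 2 + ∑ j, β j ^ 2 := by positivity
  refine h.trans (mul_le_mul_of_nonneg_right (add_le_add (Finset.sum_le_sum fun i _ ↦ ?_)
    (Finset.sum_le_sum fun j _ ↦ ?_)) hz)
  · have := ha i
    rw [← sq_abs (Mi i)]
    exact pow_le_pow_left₀ (abs_nonneg _) this 2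
  · have := hb j
    rw [← sq_abs (cj j)]
    exact pow_le_pow_left₀ (abs_nonneg _) this 2

/-- **The coupling majorant, split** (`B ≤ B₃`): an exact majorant `Ufin` on `[B, B₃)`, envelopes `a`, `b` on `[B₃, ∞)` with
`Σ_{m∈[B₃,N)} (Σ_i a_i(m)² + Σ_j b_j(m)²)/d̂_m ≤ T` for every `N`, and `d̂ > 0` on `[B, ∞)` give, for every `N`, `x`, `β`:
`Σ_{m∈[B,N)} (Σ_i M(i,m)x_i + Σ_j c(m,j)β_j)²/d̂_m ≤ Ufin(x,β) + T·(Σx² + Σβ²)` — the hypothesis `hUq` of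
`weilPositivityOn_of_formatC_cinf` with `Uq := Ufin + T‖·‖²`. -/
theorem coupling_majorant_split (M : ℕ → ℕ → ℝ) {B B₃ r : ℕ} (hBB : B ≤ B₃) (c : ℕ → Fin r → ℝ) (dhat : ℕ → ℝ)
    (hd : ∀ m, B ≤ m → 0 < dhat m)
    (Ufin : (Fin B → ℝ) → (Fin r → ℝ) → ℝ)
    (hfin : ∀ (x : Fin B → ℝ) (β : Fin r → ℝ),
      ∑ m ∈ Ico B B₃, (∑ i : Fin B, M i m * x i + ∑ j, c m j * β j) ^ 2 / dhat m ≤ Ufin x β)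
    (a : ℕ → Fin B → ℝ) (b : ℕ → Fin r → ℝ)
    (ha : ∀ m, B₃ ≤ m → ∀ i : Fin B, |M i m| ≤ a m i) (hb : ∀ m, B₃ ≤ m → ∀ j, |c m j| ≤ b m j)
    {T : ℝ} (hT : ∀ N, ∑ m ∈ Ico B₃ N, (∑ i, a m i ^ 2 + ∑ j, b m j ^ 2) / dhat m ≤ T)
    (N : ℕ) (x : Fin B → ℝ) (β : Fin r → ℝ) :
    ∑ m ∈ Ico B N, (∑ i : Fin B, M i m * x i + ∑ j, c m j * β j) ^ 2 / dhat m
      ≤ Ufin x β + T * (∑ i, x i ^ 2 + ∑ j, β j ^ 2) := by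
  have hz : 0 ≤ ∑ i, x i ^ 2 + ∑ j, β j ^ 2 := by positivity
  have hT0 : 0 ≤ T := by simpa using hT B₃
  -- split the range at `B₃` (or note the range is inside `[B, B₃)`)
  rcases le_or_gt N B₃ with hN | hN
  · -- `[B, N) ⊆ [B, B₃)`: the partial sum of nonnegative terms is below the full middle sum
    have hsub : Ico B N ⊆ Ico B B₃ := Finset.Ico_subset_Ico_right hN
    calc ∑ m ∈ Ico B N, (∑ i : Fin B, M i m * x i + ∑ j, c m j * β j) ^ 2 / dhat m
        ≤ ∑ m ∈ Ico B B₃, (∑ i : Fin B, M i m * x i + ∑ j, c m j * β j) ^ 2 / dhat m :=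
          Finset.sum_le_sum_of_subset_of_nonneg hsub fun m hm _ ↦ by
            have := hd m (Finset.mem_Ico.1 hm).1; positivity
      _ ≤ Ufin x β := hfin x β
      _ ≤ Ufin x β + T * (∑ i, x i ^ 2 + ∑ j, β j ^ 2) := le_add_of_nonneg_right (mul_nonneg hT0 hz)
  · rw [← Finset.sum_Ico_consecutive _ hBB hN.le]
    refine add_le_add (hfin x β) ?_
    calc ∑ m ∈ Ico B₃ N, (∑ i : Fin B, M i m * x i + ∑ j, c m j * β j) ^ 2 / dhat m
        ≤ ∑ m ∈ Ico B₃ N, (∑ i, a m i ^ 2 + ∑ j, b m j ^ 2) / dhat m * (∑ i, x i ^ 2 + ∑ j, β j ^ 2) :=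
          Finset.sum_le_sum fun m hm ↦ by
            have hm' : B₃ ≤ m := (Finset.mem_Ico.1 hm).1
            have hdm := hd m (hBB.trans hm')
            rw [div_mul_eq_mul_div]
            exact div_le_div_of_nonneg_right (sq_image_le_envelope_mul (ha m hm') (hb m hm') x β) hdm.le
      _ = (∑ m ∈ Ico B₃ N, (∑ i, a m i ^ 2 + ∑ j, b m j ^ 2) / dhat m) * (∑ i, x i ^ 2 + ∑ j, β j ^ 2) := by
          rw [Finset.sum_mul]
      _ ≤ T * (∑ i, x i ^ 2 + ∑ j, β j ^ 2) := mul_le_mul_of_nonneg_right (hT N) hz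

end Summit.RiemannHypothesis.RiemannHypothesis.Theorems.WeilFormatC
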